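import Summits.QuantumFields.BalabanUV.T4Continuum.Support.SmoothRefineBlocks
import HarnessLib

/-!
# T⁴ programme, node NE3 — the kinematic refinement lemma, abelian line, file 2: THE WORDS OF THE AVERAGE (42) AND THE
# FINE PLAQUETTES ON A SLICE PULLBACK (`SmoothRefineSlices`)

Cell `pub-balaban`, NE3 formalisation swarm (`t4/formal/NE3/LEAVES.md` row S4b, unit
`b2b-balaban-t4-ne3-formalise-leaf-10`); sequel of `SmoothRefineBlocks` (block coordinates `blk`/`res`, the traversed-bond
list `steps`, the slice pullback `slicePull L U` of a coarse configuration and the slice lift `sliceLift L ψ` of a coarse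
cochain).  GROUP-GENERAL lattice bookkeeping (any group `G`; nothing abelian, nothing analytic):

§4 what the words of Bałaban's average (42) ([Balaban1985Averaging] (42) p. 23, (14) p. 19; tree
`B7Prop1Explicit.{seg, treeWord, gammaWord, Wcx}`) read on a slice pullback: from ANY fine site `y` the straight `L`-segment
in direction `κ` crosses the last `κ`-slice of the block of `y` exactly once, so `hol (slicePull L U) y (seg κ L) = U ⌊y/L⌋ κ`;
the tree contour `treeWord (boxVec r)` from a block corner `L • z` never meets a last slice, so it reads `1`; hence the
contour `Γ_{c,x}` of (42) reads `hol (slicePull L U) (L • z) (gammaWord L κ (boxVec r)) = U z κ` and THE LOOP VARIABLES OF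
(42) ARE TRIVIAL: `Wcx L (slicePull L U) (L • z) κ (boxVec r) = 1`; the additive twins for `sliceLift`
(`asum (sliceLift L ψ) (L • z) (gammaWord …) = ψ z κ`);
§5 the fine plaquettes of a slice pullback: trivial except at the CORNER plaquettes of a block
(`res y μ = res y ν = L − 1`), where they ARE the coarse plaquettes of `U`; additive twin for `sliceLift`.
(These are the facts behind the «slice correction» of the row: modifying all `L^{d−1}` last-slice bonds of a coarse bond
by the same group element changes the block average of an abelian configuration multiplicatively and exactly.)

HONEST FRAMING: finite-`T⁴` kinematics of block averaging (rung (B)+1 — NOT infinite volume, NOT a mass gap, NOT Clay);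
no estimate, nothing of NE3 claimed; no `BetaPertH`, no (B), no G-an2-4; no printed sentence is a hypothesis.
PLACEMENT (human rule 2026-08-19): our work, under `Summits/QuantumFields/BalabanUV/`.
-/

set_option autoImplicit false

open scoped BigOperators

namespace Summit.QuantumFields.BalabanUV.T4Continuum.SmoothRefineSlices

open Literature.MathematicalPhysics.QuantumFieldTheory.Balaban1983to89
open B7Prop1Explicit B7Prop2Explicit SmoothRefineBlocks

noncomputable section

variable {d : ℕ}


/-! ## §4 What the words of the average (42) read on a slice pullback / slice lift -/

section Words

variable {G : Type*} [Group G]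

/-- Along a forward segment of length `n ≤ L − ρ_κ… `: if none of the bonds `⟨x + t e_κ, +e_κ⟩`, `t < n`, lies on the last
slice, the pullback reads `1`. [folklore] -/
theorem hol_slicePull_seg_eq_one {L : ℕ} (U : Site d → Fin d → G) (κ : Fin d) (n : ℕ) (x : Site d)
    (h : ∀ t : ℕ, t < n → res L (x + (t : ℤ) • e κ) κ ≠ (L : ℤ) - 1) : hol (slicePull L U) x (seg κ n) = 1 := by
  refine hol_eq_one_of_steps _ x _ fun s hs => ?_
  obtain ⟨t, ht, rfl⟩ := mem_steps_seg κ n x s hs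
  simp only [stepHol_true]
  exact slicePull_of_ne U (h t ht)

/-- The offset in direction `κ` along the segment from a point of offset `ρ`: `res (y + t e_κ) κ = ρ_κ + t` while
`ρ_κ + t < L`. [folklore] -/
theorem res_add_smul_e {L : ℕ} (hL : 1 ≤ L) (y : Site d) (κ : Fin d) (t : ℕ) (ht : res L y κ + t < L) :
    res L (y + (t : ℤ) • e κ) κ = res L y κ + t ∧ blk L (y + (t : ℤ) • e κ) = blk L y := by
  have key := blk_res_eq_of (y := y + (t : ℤ) • e κ) (z := blk L y) (ρ := res L y + (t : ℤ) • e κ) hL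
    (by rw [← add_assoc, blk_add_res]) (fun i => by
      simp only [Pi.add_apply, Pi.smul_apply, smul_eq_mul, e_apply]
      split_ifs
      · have := res_nonneg hL y i; positivity
      · simp only [mul_zero, add_zero]; exact res_nonneg hL y i)
    (fun i => by
      simp only [Pi.add_apply, Pi.smul_apply, smul_eq_mul, e_apply]
      split_ifs with hi
      · subst hi; simpa using ht
      · simp only [mul_zero, add_zero]; exact res_lt hL y i)
  refine ⟨?_, key.1⟩
  have := congr_fun key.2 κ
  simpa [e_apply] using this

/-- **The straight contour of a coarse bond on the pullback**: from any point `y` of offset `ρ` the `L`-segment in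
direction `κ` crosses the last `κ`-slice of the block of `y` exactly once, so
`hol (slicePull L U) y (seg κ L) = U (blk L y) κ`. [folklore] -/
theorem hol_slicePull_seg {L : ℕ} (hL : 1 ≤ L) (U : Site d → Fin d → G) (y : Site d) (κ : Fin d) :
    hol (slicePull L U) y (seg κ L) = U (blk L y) κ := by
  -- split the segment at the crossing bond `t* = L − 1 − ρ_κ`
  obtain ⟨m, hm⟩ : ∃ m : ℕ, res L y κ = m := Int.eq_ofNat_of_zero_le (res_nonneg hL y κ)
  have hmL : m + 1 ≤ L := by have := res_lt hL y κ; rw [hm] at this; exact_mod_cast this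
  set ts : ℕ := L - 1 - m with hts
  have hsplit : seg κ (L : ℤ) = seg κ (ts : ℤ) ++ ([(κ, true)] ++ seg κ ((L - 1 - ts : ℕ) : ℤ)) := by
    rw [seg_natCast, seg_natCast, seg_natCast, show ([(κ, true)] : List (Letter d)) = List.replicate 1 (κ, true) from rfl,
      ← List.replicate_add, ← List.replicate_add]
    congr 1; omega
  -- the crossing point
  have hcross := res_add_smul_e hL y κ ts (by rw [hm]; omega)
  have hres : res L (y + (ts : ℤ) • e κ) κ = (L : ℤ) - 1 := by
    rw [hcross.1, hm]; omega
  -- before the crossing: offsets `m + t < L − 1`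
  have hA : hol (slicePull L U) y (seg κ ts) = 1 := by
    refine hol_slicePull_seg_eq_one U κ ts y fun t ht => ?_
    have := res_add_smul_e hL y κ t (by rw [hm]; omega)
    rw [this.1, hm]; omega
  -- after the crossing: offsets `t < L − 1`
  have hC : hol (slicePull L U) (y + (ts : ℤ) • e κ + e κ) (seg κ ((L - 1 - ts : ℕ) : ℤ)) = 1 := by
    refine hol_slicePull_seg_eq_one U κ _ _ fun t ht => ?_
    have hstep := blk_res_add_e hL (y + (ts : ℤ) • e κ) κ
    rw [hres] at hstep
    have h0 : res L (y + (ts : ℤ) • e κ + e κ) κ = 0 := by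
      rw [hstep.2, if_pos rfl, Pi.sub_apply, hres, Pi.smul_apply, e_apply, if_pos rfl, smul_eq_mul, mul_one, sub_self]
    have := res_add_smul_e hL (y + (ts : ℤ) • e κ + e κ) κ t (by rw [h0]; omega)
    rw [this.1, h0]; omega
  rw [hsplit, hol_append, hol_append, disp_seg, hA, one_mul, hol_cons, hol_nil, mul_one, stepHol_true,
    slicePull_of_eq U hres, hcross.2]
  simp only [disp_cons, disp_nil, add_zero, Letter.vec_true]
  rw [hC, mul_one]

/-- **The tree contour from a block corner on the pullback is trivial**: `treeWord (boxVec r)` read from `L • z` stays in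
the block `[Lz, Lz + (L−1)]^d` and moves in direction `κ` only at offsets `< r_κ ≤ L − 1`, so it never meets a last slice.
[folklore] -/
theorem hol_slicePull_treeWord {L : ℕ} (hL : 1 ≤ L) (U : Site d → Fin d → G) (z : Site d) (r : Fin d → Fin L) :
    hol (slicePull L U) ((L : ℤ) • z) (treeWord (boxVec L r)) = 1 := by
  refine hol_eq_one_of_steps _ _ _ fun s hs => ?_
  obtain ⟨y, κ, rfl, hy, hy'⟩ := mem_steps_treeWord _ _ (fun κ => by simp [boxVec]) s hs
  simp only [stepHol_true]
  refine slicePull_of_ne U ?_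
  -- `y = Lz + u` with `0 ≤ u`, `u_κ + 1 ≤ r_κ ≤ L − 1`
  have hu := blk_res_eq_of (y := y) (z := z) (ρ := y - (L : ℤ) • z) hL (by abel) (fun i => by
      have := hy i; simp only [Pi.sub_apply, Pi.smul_apply, smul_eq_mul] at this ⊢; linarith)
    (fun i => by
      have h1 := hy' i
      simp only [Pi.add_apply, Pi.smul_apply, smul_eq_mul, e_apply, boxVec, Pi.sub_apply] at h1 ⊢
      have h2 : ((r i : ℕ) : ℤ) < L := by exact_mod_cast (r i).isLt
      split_ifs at h1 <;> linarith)
  rw [hu.2]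
  have h1 := hy' κ
  simp only [Pi.add_apply, Pi.smul_apply, smul_eq_mul, e_apply, ↓reduceIte, boxVec, Pi.sub_apply] at h1 ⊢
  have h2 : ((r κ : ℕ) : ℤ) < L := by exact_mod_cast (r κ).isLt
  linarith

/-- **The contour `Γ_{c,x}` of (42) on the pullback**: `hol (slicePull L U) (L • z) (gammaWord L κ (boxVec r)) = U z κ`.
[folklore] -/
theorem hol_slicePull_gammaWord {L : ℕ} (hL : 1 ≤ L) (U : Site d → Fin d → G) (z : Site d) (κ : Fin d)
    (r : Fin d → Fin L) : hol (slicePull L U) ((L : ℤ) • z) (gammaWord L κ (boxVec L r)) = U z κ := by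
  rw [gammaWord, hol_append, hol_append, disp_append, disp_treeWord, disp_seg, hol_slicePull_treeWord hL, one_mul,
    hol_slicePull_seg hL, blk_boxVec hL,
    hol_revWord' _ (x := (L : ℤ) • z + (L : ℤ) • e κ) _ _ (by rw [disp_treeWord]; abel), ← smul_add,
    hol_slicePull_treeWord hL, inv_one, mul_one]

end Words

section WordsAvg

variable {𝔸 : Type*} [NormedRing 𝔸]

/-- **The loop variables of (42) are trivial on a slice pullback**: `Wcx L (slicePull L U) (L • z) κ (boxVec r) = 1`.
[folklore] -/
theorem Wcx_slicePull {L : ℕ} (hL : 1 ≤ L) (U : Site d → Fin d → 𝔸ˣ) (z : Site d) (κ : Fin d)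
    (r : Fin d → Fin L) : Wcx L (slicePull L U) ((L : ℤ) • z) κ (boxVec L r) = 1 := by
  rw [Wcx, hol_slicePull_gammaWord hL, hol_slicePull_seg hL, (blk_res_smul hL _).1, mul_inv_cancel]

end WordsAvg

section WordsLift

variable {X : Type*} [NormedRing X]

/-- The contour sum of a slice lift along a forward segment avoiding the last slice vanishes. [folklore] -/
theorem asum_sliceLift_seg_eq_zero {L : ℕ} (ψ : Site d → Fin d → X) (κ : Fin d) (n : ℕ) (x : Site d)
    (h : ∀ t : ℕ, t < n → res L (x + (t : ℤ) • e κ) κ ≠ (L : ℤ) - 1) : asum (sliceLift L ψ) x (seg κ n) = 0 := by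
  refine asum_eq_zero_of_steps _ x _ fun s hs => ?_
  obtain ⟨t, ht, rfl⟩ := mem_steps_seg κ n x s hs
  simp only [stepA_true]
  exact sliceLift_of_ne ψ (h t ht)

/-- `asum (sliceLift L ψ) y (seg κ L) = ψ (blk L y) κ`. [folklore] -/
theorem asum_sliceLift_seg {L : ℕ} (hL : 1 ≤ L) (ψ : Site d → Fin d → X) (y : Site d) (κ : Fin d) :
    asum (sliceLift L ψ) y (seg κ L) = ψ (blk L y) κ := by
  obtain ⟨m, hm⟩ : ∃ m : ℕ, res L y κ = m := Int.eq_ofNat_of_zero_le (res_nonneg hL y κ)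
  have hmL : m + 1 ≤ L := by have := res_lt hL y κ; rw [hm] at this; exact_mod_cast this
  set ts : ℕ := L - 1 - m with hts
  have hsplit : seg κ (L : ℤ) = seg κ (ts : ℤ) ++ ([(κ, true)] ++ seg κ ((L - 1 - ts : ℕ) : ℤ)) := by
    rw [seg_natCast, seg_natCast, seg_natCast, show ([(κ, true)] : List (Letter d)) = List.replicate 1 (κ, true) from rfl,
      ← List.replicate_add, ← List.replicate_add]
    congr 1; omega
  have hcross := res_add_smul_e hL y κ ts (by rw [hm]; omega)
  have hres : res L (y + (ts : ℤ) • e κ) κ = (L : ℤ) - 1 := by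
    rw [hcross.1, hm]; omega
  have hA : asum (sliceLift L ψ) y (seg κ ts) = 0 := by
    refine asum_sliceLift_seg_eq_zero ψ κ ts y fun t ht => ?_
    have := res_add_smul_e hL y κ t (by rw [hm]; omega)
    rw [this.1, hm]; omega
  have hC : asum (sliceLift L ψ) (y + (ts : ℤ) • e κ + e κ) (seg κ ((L - 1 - ts : ℕ) : ℤ)) = 0 := by
    refine asum_sliceLift_seg_eq_zero ψ κ _ _ fun t ht => ?_
    have hstep := blk_res_add_e hL (y + (ts : ℤ) • e κ) κ
    rw [hres] at hstep
    have h0 : res L (y + (ts : ℤ) • e κ + e κ) κ = 0 := by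
      rw [hstep.2, if_pos rfl, Pi.sub_apply, hres, Pi.smul_apply, e_apply, if_pos rfl, smul_eq_mul, mul_one, sub_self]
    have := res_add_smul_e hL (y + (ts : ℤ) • e κ + e κ) κ t (by rw [h0]; omega)
    rw [this.1, h0]; omega
  rw [hsplit, asum_append, asum_append, disp_seg, hA, zero_add, asum_cons, asum_nil, add_zero, stepA_true,
    sliceLift_of_eq ψ hres, hcross.2]
  simp only [disp_cons, disp_nil, add_zero, Letter.vec_true]
  rw [hC, add_zero]

/-- The contour sum of a slice lift along the tree contour from a block corner vanishes. [folklore] -/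
theorem asum_sliceLift_treeWord {L : ℕ} (hL : 1 ≤ L) (ψ : Site d → Fin d → X) (z : Site d) (r : Fin d → Fin L) :
    asum (sliceLift L ψ) ((L : ℤ) • z) (treeWord (boxVec L r)) = 0 := by
  refine asum_eq_zero_of_steps _ _ _ fun s hs => ?_
  obtain ⟨y, κ, rfl, hy, hy'⟩ := mem_steps_treeWord _ _ (fun κ => by simp [boxVec]) s hs
  simp only [stepA_true]
  refine sliceLift_of_ne ψ ?_
  have hu := blk_res_eq_of (y := y) (z := z) (ρ := y - (L : ℤ) • z) hL (by abel) (fun i => by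
      have := hy i; simp only [Pi.sub_apply, Pi.smul_apply, smul_eq_mul] at this ⊢; linarith)
    (fun i => by
      have h1 := hy' i
      simp only [Pi.add_apply, Pi.smul_apply, smul_eq_mul, e_apply, boxVec, Pi.sub_apply] at h1 ⊢
      have h2 : ((r i : ℕ) : ℤ) < L := by exact_mod_cast (r i).isLt
      split_ifs at h1 <;> linarith)
  rw [hu.2]
  have h1 := hy' κ
  simp only [Pi.add_apply, Pi.smul_apply, smul_eq_mul, e_apply, ↓reduceIte, boxVec, Pi.sub_apply] at h1 ⊢
  have h2 : ((r κ : ℕ) : ℤ) < L := by exact_mod_cast (r κ).isLt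
  linarith

/-- **The contour functional of (42) on a slice lift**: `asum (sliceLift L ψ) (L • z) (gammaWord L κ (boxVec r)) = ψ z κ`
(B7 p. 25's `A(Γ_{c,x})` for `A` = the lift). [folklore] -/
theorem asum_sliceLift_gammaWord {L : ℕ} (hL : 1 ≤ L) (ψ : Site d → Fin d → X) (z : Site d) (κ : Fin d)
    (r : Fin d → Fin L) : asum (sliceLift L ψ) ((L : ℤ) • z) (gammaWord L κ (boxVec L r)) = ψ z κ := by
  rw [asum_gammaWord, asum_sliceLift_treeWord hL, zero_add, asum_sliceLift_seg hL, blk_boxVec hL, ← smul_add,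
    asum_sliceLift_treeWord hL, sub_zero]

end WordsLift

/-! ## §5 The fine plaquettes of a slice pullback / slice lift -/

section Plaq

variable {G : Type*} [Group G]

/-- **The fine plaquettes of the slice pullback**: trivial, except at the CORNER plaquettes of the block
(`res y μ = res y ν = L − 1`), where they are the coarse plaquettes of `U`. [folklore] -/
theorem hol_slicePull_plaqWord {L : ℕ} (hL : 1 ≤ L) (U : Site d → Fin d → G) (y : Site d) {μ ν : Fin d}
    (hμν : μ ≠ ν) :
    hol (slicePull L U) y (plaqWord μ ν) =
      if res L y μ = (L : ℤ) - 1 ∧ res L y ν = (L : ℤ) - 1 then hol U (blk L y) (plaqWord μ ν) else 1 := by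
  have hνμ : ν ≠ μ := fun h => hμν h.symm
  have s1 : ∀ w : Site d, w + e μ + e ν - e μ = w + e ν := fun w => by abel
  have s2 : ∀ w : Site d, w + e μ + e ν + -e μ - e ν = w := fun w => by abel
  simp only [plaqWord, hol_cons, hol_nil, mul_one, stepHol_true, stepHol_false, Letter.vec_true, Letter.vec_false, s1, s2,
    slicePull, res_add_e_ne hL y hνμ, res_add_e_ne hL y hμν, blk_add_e hL]
  by_cases hμ : res L y μ = (L : ℤ) - 1 <;> by_cases hν : res L y ν = (L : ℤ) - 1 <;> simp [hμ, hν]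

end Plaq

section PlaqLift

variable {X : Type*} [NormedRing X]

/-- **The fine plaquette sums of a slice lift** (the additive twin): zero, except at the corner plaquettes, where they
are the coarse plaquette sums of `ψ`. [folklore] -/
theorem asum_sliceLift_plaqWord {L : ℕ} (hL : 1 ≤ L) (ψ : Site d → Fin d → X) (y : Site d) {μ ν : Fin d}
    (hμν : μ ≠ ν) :
    asum (sliceLift L ψ) y (plaqWord μ ν) =
      if res L y μ = (L : ℤ) - 1 ∧ res L y ν = (L : ℤ) - 1 then asum ψ (blk L y) (plaqWord μ ν) else 0 := by
  have hνμ : ν ≠ μ := fun h => hμν h.symm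
  rw [asum_plaqWord, asum_plaqWord]
  simp only [sliceLift, res_add_e_ne hL y hνμ, res_add_e_ne hL y hμν, blk_add_e hL]
  by_cases hμ : res L y μ = (L : ℤ) - 1 <;> by_cases hν : res L y ν = (L : ℤ) - 1 <;> simp [hμ, hν]

end PlaqLift

end

end Summit.QuantumFields.BalabanUV.T4Continuum.SmoothRefineSlices
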